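import Summits.CriticalPhenomena.PercolationContinuityZ3.Theorems.PercNearOneGluingNoHeavyLowerTailSahiHittingBoxRecursive
import HarnessLib

/-!
# `NoHeavyLowerTail` (stmt-CriticalPhenomena-4575) — term-list infrastructure for the memoising box checker: actual degrees, normal form,
# relabelling of variables

Support file, seat `prim-l12-p5` (gen 11), `--supports stmt-CriticalPhenomena-4575`.  Standard axioms; computable list operations; no sorries,
no `native_decide`.  First half of the order-6 engine (`…SahiHittingBoxMemo` is the checker proper): for term lists `(c, [e_0,…])` with the
`evalKL` semantics of `…SahiPolyReflectFast`,
* `maxE`, `degKey`, `getD_le_degKey`, `idxPos`, `occVars`, `mem_occVars`, `pickVar`, `pickVar_spec` — occurring variables and ACTUAL degrees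
  (the variable to slice is an occurring variable of least actual degree; the Bernstein degree used is its maximal exponent at the node);
* `lexLtK`, `sortK`, `gcdK`, `primK`, `normK` (sort by key, merge equal keys — `mergeAdj` of `…SahiPolyReflectFast` —, drop zeros, divide by the
  gcd of the coefficients), `nonneg_of_normK`, `normK_nonneg`, `key_of_mem_normK`;
* `relabelK ord L` (new variable `i` carries the exponent of old variable `ord[i]`), the points `pushX`/`pullX`, and the two relabelling
  identities `evalKL (relabelK ord L) (pushX ord x) = evalKL L x`, `evalKL (relabelK ord L) y = evalKL L (pullX ord y)` (every occurring
  variable listed in `ord`, no duplicates, entries `< k`) — the unit box being invariant under coordinate permutations, box-nonnegativity is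
  invariant under relabelling, which is what the checker's cache exploits.
[this work; folklore]
-/

namespace Summit.CriticalPhenomena.PercolationContinuityZ3.Theorems

namespace SahiHitting

open Finset SparseBernstein

variable {k : ℕ}
/-! ## A. Pointwise maxima of keys; occurring variables; actual degrees -/

/-- Pointwise maximum of two exponent lists (shorter list padded with `0`). [folklore] -/
def maxE : List ℕ → List ℕ → List ℕ
  | [], b => b
  | a, [] => a
  | x :: xs, y :: ys => max x y :: maxE xs ys

/-- `maxE` is the pointwise maximum. [folklore] -/
theorem getD_maxE : ∀ (a b : List ℕ) (i : ℕ), (maxE a b).getD i 0 = max (a.getD i 0) (b.getD i 0)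
  | [], b, i => by simp [maxE]
  | x :: xs, [], i => by simp [maxE]
  | x :: xs, y :: ys, 0 => by simp [maxE]
  | x :: xs, y :: ys, i + 1 => by simp only [maxE, List.getD_cons_succ]; exact getD_maxE xs ys i

/-- Length of `maxE`. [folklore] -/
theorem length_maxE : ∀ (a b : List ℕ), (maxE a b).length = max a.length b.length
  | [], b => by simp [maxE]
  | x :: xs, [] => by simp [maxE]
  | x :: xs, y :: ys => by simp [maxE, length_maxE xs ys, Nat.add_max_add_right]

/-- The DEGREE KEY of a term list: entry `i` is the maximal exponent of `x_i`. [this work] -/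
def degKey (L : List (ℤ × List ℕ)) : List ℕ := L.foldr (fun t acc => maxE t.2 acc) []

/-- Every exponent is bounded by the degree key. [this work] -/
theorem getD_le_degKey : ∀ (L : List (ℤ × List ℕ)) (t : ℤ × List ℕ), t ∈ L → ∀ i, t.2.getD i 0 ≤ (degKey L).getD i 0
  | [], t, ht, i => by simp at ht
  | s :: L, t, ht, i => by
    rw [degKey, List.foldr_cons, ← degKey, getD_maxE]
    rcases List.mem_cons.1 ht with rfl | ht
    · exact le_max_left _ _
    · exact (getD_le_degKey L t ht i).trans (le_max_right _ _)

/-- Key lengths are bounded by the length of the degree key. [this work] -/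
theorem length_le_degKey : ∀ (L : List (ℤ × List ℕ)) (t : ℤ × List ℕ), t ∈ L → t.2.length ≤ (degKey L).length
  | [], t, ht => by simp at ht
  | s :: L, t, ht => by
    rw [degKey, List.foldr_cons, ← degKey, length_maxE]
    rcases List.mem_cons.1 ht with rfl | ht
    · exact le_max_left _ _
    · exact (length_le_degKey L t ht).trans (le_max_right _ _)

/-- The degree key is no longer than the longest key. [this work] -/
theorem degKey_length_le : ∀ (L : List (ℤ × List ℕ)) (m : ℕ), (∀ t ∈ L, t.2.length ≤ m) → (degKey L).length ≤ m
  | [], m, _ => by simp [degKey]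
  | s :: L, m, h => by
    rw [degKey, List.foldr_cons, ← degKey, length_maxE]
    exact max_le (h s (by simp)) (degKey_length_le L m fun t ht => h t (by simp [ht]))

/-- Indices (offset by `j`) of the positive entries of a list. [folklore] -/
def idxPos : List ℕ → ℕ → List ℕ
  | [], _ => []
  | d :: ds, j => if d = 0 then idxPos ds (j + 1) else j :: idxPos ds (j + 1)

/-- Members of `idxPos l j` are `≥ j`. [folklore] -/
theorem le_of_mem_idxPos : ∀ (l : List ℕ) (j x : ℕ), x ∈ idxPos l j → j ≤ x
  | [], j, x, hx => by simp [idxPos] at hx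
  | d :: ds, j, x, hx => by
    unfold idxPos at hx
    split_ifs at hx with h
    · exact (Nat.le_succ j).trans (le_of_mem_idxPos ds (j + 1) x hx)
    · rcases List.mem_cons.1 hx with rfl | hx
      · exact le_rfl
      · exact (Nat.le_succ j).trans (le_of_mem_idxPos ds (j + 1) x hx)

/-- Members of `idxPos l j` are `< j + l.length`. [folklore] -/
theorem lt_of_mem_idxPos : ∀ (l : List ℕ) (j x : ℕ), x ∈ idxPos l j → x < j + l.length
  | [], j, x, hx => by simp [idxPos] at hx
  | d :: ds, j, x, hx => by
    unfold idxPos at hx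
    have aux : ∀ y, y ∈ idxPos ds (j + 1) → y < j + (d :: ds).length := fun y hy => by
      have := lt_of_mem_idxPos ds (j + 1) y hy; simp only [List.length_cons]; omega
    split_ifs at hx with h
    · exact aux x hx
    · rcases List.mem_cons.1 hx with rfl | hx
      · simp
      · exact aux x hx

/-- `idxPos` has no duplicates. [folklore] -/
theorem nodup_idxPos : ∀ (l : List ℕ) (j : ℕ), (idxPos l j).Nodup
  | [], j => by simp [idxPos]
  | d :: ds, j => by
    unfold idxPos
    split_ifs with h
    · exact nodup_idxPos ds (j + 1)
    · refine List.nodup_cons.2 ⟨fun hj => ?_, nodup_idxPos ds (j + 1)⟩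
      have := le_of_mem_idxPos ds (j + 1) j hj; omega

/-- A positive entry's index is listed. [folklore] -/
theorem mem_idxPos : ∀ (l : List ℕ) (j i : ℕ), l.getD i 0 ≠ 0 → j + i ∈ idxPos l j
  | [], j, i, h => by simp at h
  | d :: ds, j, 0, h => by
    simp only [List.getD_cons_zero] at h
    simp [idxPos, h]
  | d :: ds, j, i + 1, h => by
    simp only [List.getD_cons_succ] at h
    have := mem_idxPos ds (j + 1) i h
    rw [show j + (i + 1) = j + 1 + i by omega]
    unfold idxPos
    split_ifs
    · exact this
    · exact List.mem_cons_of_mem _ this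

/-- Length of `idxPos`. [folklore] -/
theorem length_idxPos_le : ∀ (l : List ℕ) (j : ℕ), (idxPos l j).length ≤ l.length
  | [], j => by simp [idxPos]
  | d :: ds, j => by
    unfold idxPos; split_ifs
    · exact (length_idxPos_le ds (j + 1)).trans (Nat.le_succ _)
    · simpa using length_idxPos_le ds (j + 1)

/-- The occurring variables of a term list (increasing). [this work] -/
def occVars (L : List (ℤ × List ℕ)) : List ℕ := idxPos (degKey L) 0

/-- A variable with a nonzero exponent somewhere occurs. [this work] -/
theorem mem_occVars {L : List (ℤ × List ℕ)} {t : ℤ × List ℕ} (ht : t ∈ L) {i : ℕ} (hi : t.2.getD i 0 ≠ 0) : i ∈ occVars L := by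
  have h := getD_le_degKey L t ht i
  have : (degKey L).getD i 0 ≠ 0 := by omega
  simpa [occVars] using mem_idxPos (degKey L) 0 i this

/-- Occurring variables are below the length of the degree key. [this work] -/
theorem lt_of_mem_occVars {L : List (ℤ × List ℕ)} {i : ℕ} (hi : i ∈ occVars L) : i < (degKey L).length := by
  simpa using lt_of_mem_idxPos (degKey L) 0 i hi

/-- Scan a degree key for the first index of minimal positive entry. [this work] -/
def pickGo : List ℕ → ℕ → Option (ℕ × ℕ) → Option (ℕ × ℕ)
  | [], _, acc => acc
  | d :: ds, j, acc => pickGo ds (j + 1)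
      (if d = 0 then acc else match acc with
        | none => some (j, d)
        | some (j', d') => if d < d' then some (j, d) else some (j', d'))

/-- The variable to slice: an occurring variable of least actual degree; returns `(i, actual degree of x_i)` (degree re-read from the key,
so that no property of the scan is needed). [this work] -/
def pickVar (L : List (ℤ × List ℕ)) : Option (ℕ × ℕ) :=
  match pickGo (degKey L) 0 none with
  | none => none
  | some (i, _) => if (degKey L).getD i 0 = 0 then none else some (i, (degKey L).getD i 0)

/-- Specification of `pickVar`: the returned degree is the positive maximal exponent of the returned variable. [this work] -/
theorem pickVar_spec {L : List (ℤ × List ℕ)} {i d : ℕ} (h : pickVar L = some (i, d)) : (degKey L).getD i 0 = d ∧ 0 < d := by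
  unfold pickVar at h
  split at h
  · simp at h
  · split_ifs at h with hd
    simp only [Option.some.injEq, Prod.mk.injEq] at h
    obtain ⟨rfl, rfl⟩ := h
    exact ⟨rfl, Nat.pos_of_ne_zero hd⟩

/-! ## B. Normal form -/

/-- Strict lexicographic order on exponent lists. [folklore] -/
def lexLtK : List ℕ → List ℕ → Bool
  | [], [] => false
  | [], _ :: _ => true
  | _ :: _, [] => false
  | a :: as, b :: bs => Nat.blt a b || (a == b && lexLtK as bs)

/-- Sort terms by key. [folklore] -/
def sortK (L : List (ℤ × List ℕ)) : List (ℤ × List ℕ) := L.mergeSort fun s t => !lexLtK t.2 s.2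

/-- gcd of the absolute values of the coefficients. [folklore] -/
def gcdK : List (ℤ × List ℕ) → ℕ
  | [] => 0
  | t :: L => Nat.gcd t.1.natAbs (gcdK L)

/-- The gcd divides every coefficient. [folklore] -/
theorem gcdK_dvd : ∀ (L : List (ℤ × List ℕ)) (t : ℤ × List ℕ), t ∈ L → ((gcdK L : ℕ) : ℤ) ∣ t.1
  | [], t, ht => by simp at ht
  | s :: L, t, ht => by
    rcases List.mem_cons.1 ht with rfl | ht
    · exact Int.natCast_dvd.2 (by simpa [gcdK] using Nat.gcd_dvd_left _ _)
    · have h1 : ((gcdK (s :: L) : ℕ) : ℤ) ∣ (gcdK L : ℤ) := Int.natCast_dvd_natCast.2 (Nat.gcd_dvd_right _ _)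
      exact h1.trans (gcdK_dvd L t ht)

/-- Divide all coefficients by their gcd when it is `≥ 2`. [folklore] -/
def primK (L : List (ℤ × List ℕ)) : List (ℤ × List ℕ) :=
  if gcdK L ≤ 1 then L else L.map fun t => (t.1 / (gcdK L : ℤ), t.2)

/-- The primitive part is a positive multiple: `evalKL L = c · evalKL (primK L)` with `c > 0`. [folklore] -/
theorem evalKL_primK (L : List (ℤ × List ℕ)) (x : Fin k → ℝ) : ∃ c : ℝ, 0 < c ∧ evalKL k L x = c * evalKL k (primK L) x := by
  unfold primK
  split_ifs with h
  · exact ⟨1, one_pos, by rw [one_mul]⟩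
  · refine ⟨(gcdK L : ℝ), by exact_mod_cast (show 0 < gcdK L by omega), ?_⟩
    unfold evalKL
    rw [List.map_map, ← List.sum_map_mul_left]
    congr 1
    refine List.map_congr_left fun t ht => ?_
    simp only [Function.comp]
    obtain ⟨q, hq⟩ := gcdK_dvd L t ht
    rw [hq, Int.mul_ediv_cancel_left _ (by exact_mod_cast (show gcdK L ≠ 0 by omega))]
    push_cast; ring

/-- Normal form: sorted by key, equal keys merged, zero terms dropped, primitive. [this work] -/
def normK (L : List (ℤ × List ℕ)) : List (ℤ × List ℕ) := primK (dropZeroK (mergeAdj (sortK L)))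

/-- `evalKL (dropZeroK (mergeAdj (sortK L))) = evalKL L`. [folklore] -/
theorem evalKL_dms (L : List (ℤ × List ℕ)) (x : Fin k → ℝ) : evalKL k (dropZeroK (mergeAdj (sortK L))) x = evalKL k L x := by
  rw [evalKL_dropZeroK, evalKL_mergeAdj, sortK, evalKL_perm (List.mergeSort_perm L _)]

/-- Box-nonnegativity of the normal form gives box-nonnegativity. [this work] -/
theorem nonneg_of_normK {L : List (ℤ × List ℕ)} {x : Fin k → ℝ} (h : 0 ≤ evalKL k (normK L) x) : 0 ≤ evalKL k L x := by
  obtain ⟨c, hc, hcx⟩ := evalKL_primK (dropZeroK (mergeAdj (sortK L))) x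
  rw [← evalKL_dms L x, hcx]
  exact mul_nonneg hc.le h

/-- Keys of `mergeAux t rest` are the key of `t` or keys of `rest`. [folklore] -/
theorem key_of_mem_mergeAux : ∀ (t : ℤ × List ℕ) (rest : List (ℤ × List ℕ)) (u : ℤ × List ℕ),
    u ∈ mergeAux t rest → u.2 = t.2 ∨ ∃ s ∈ rest, u.2 = s.2
  | t, [], u, hu => by simp [mergeAux] at hu; exact Or.inl (by rw [hu])
  | t, s :: ss, u, hu => by
    unfold mergeAux at hu
    split_ifs at hu with h
    · rcases key_of_mem_mergeAux _ ss u hu with h1 | ⟨s', hs', h1⟩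
      · exact Or.inl h1
      · exact Or.inr ⟨s', by simp [hs'], h1⟩
    · rcases List.mem_cons.1 hu with rfl | hu
      · exact Or.inl rfl
      · rcases key_of_mem_mergeAux s ss u hu with h1 | ⟨s', hs', h1⟩
        · exact Or.inr ⟨s, by simp, h1⟩
        · exact Or.inr ⟨s', by simp [hs'], h1⟩

/-- Keys of the normal form are keys of the input. [this work] -/
theorem key_of_mem_normK {L : List (ℤ × List ℕ)} {u : ℤ × List ℕ} (hu : u ∈ normK L) : ∃ t ∈ L, u.2 = t.2 := by
  have main : ∀ v ∈ dropZeroK (mergeAdj (sortK L)), ∃ t ∈ L, v.2 = t.2 := by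
    intro v hv
    have hv := mem_of_mem_dropZeroK hv
    have hperm : ∀ s ∈ sortK L, s ∈ L := fun s hs => (List.mergeSort_perm L _).subset hs
    cases hL : sortK L with
    | nil => rw [hL] at hv; simp [mergeAdj] at hv
    | cons t rest =>
      rw [hL, mergeAdj] at hv
      rcases key_of_mem_mergeAux t rest v hv with h | ⟨s, hs, h⟩
      · exact ⟨t, hperm t (by simp [hL]), h⟩
      · exact ⟨s, hperm s (by simp [hL, hs]), h⟩
  unfold normK primK at hu
  split_ifs at hu with h
  · exact main u hu
  · obtain ⟨v, hv, rfl⟩ := List.mem_map.1 hu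
    exact main v hv

/-! ## C. Relabelling -/

/-- Relabel: new variable `i` carries the exponent of old variable `ord[i]`. [this work] -/
def relabelK (ord : List ℕ) (L : List (ℤ × List ℕ)) : List (ℤ × List ℕ) :=
  L.map fun t => (t.1, let a := t.2.toArray; ord.map fun j => a.getD j 0)

/-- Reading an exponent through the array copy. [folklore] -/
theorem array_getD_eq (l : List ℕ) (j : ℕ) : l.toArray.getD j 0 = l.getD j 0 := by
  rw [List.getD_eq_getElem?_getD]
  unfold Array.getD
  split
  · next h => simp [List.getElem?_eq_getElem (show j < l.length by simpa using h)]
  · next h => simp [List.getElem?_eq_none_iff.2 (show l.length ≤ j by simpa using h)]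

/-- Coordinates extended by `0` beyond `k`. [folklore] -/
noncomputable def xN (x : Fin k → ℝ) (j : ℕ) : ℝ := if h : j < k then x ⟨j, h⟩ else 0

/-- The relabelled point: coordinate `i` is old coordinate `ord[i]` (else `0`). [this work] -/
noncomputable def pushX (ord : List ℕ) (x : Fin k → ℝ) : Fin k → ℝ := fun i => xN x (ord.getD i.1 k)

/-- The relabelled point lies in the box. [this work] -/
theorem pushX_box (ord : List ℕ) {x : Fin k → ℝ} (hx : ∀ i, 0 ≤ x i ∧ x i ≤ 1) (i : Fin k) :
    0 ≤ pushX ord x i ∧ pushX ord x i ≤ 1 := by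
  unfold pushX xN; split_ifs
  · exact hx _
  · exact ⟨le_rfl, zero_le_one⟩

/-- Mapping over `range (length l)` through `getD` is mapping over `l`. [folklore] -/
theorem map_range_getD {β : Type*} (f : ℕ → β) : ∀ (l : List ℕ) (d : ℕ),
    (List.range l.length).map (fun i => f (l.getD i d)) = l.map f
  | [], d => by simp
  | a :: as, d => by
    rw [List.length_cons, List.range_succ_eq_map, List.map_cons, List.map_map, List.map_cons]
    congr 1
    exact (map_range_getD f as d)

/-- A nodup list of naturals below `k` has length `≤ k`. [folklore] -/
theorem length_le_of_nodup_lt {ord : List ℕ} (hnd : ord.Nodup) (hlt : ∀ j ∈ ord, j < k) : ord.length ≤ k := by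
  have h1 : ord.toFinset ⊆ Finset.range k := fun j hj => Finset.mem_range.2 (hlt j (List.mem_toFinset.1 hj))
  have := Finset.card_le_card h1
  rwa [List.toFinset_card_of_nodup hnd, Finset.card_range] at this

/-- **The relabelling identity**: if every occurring variable of `L` is listed in `ord` (no duplicates, entries `< k`), then
`evalKL (relabelK ord L) (pushX ord x) = evalKL L x`. [this work] -/
theorem evalKL_relabelK (ord : List ℕ) (L : List (ℤ × List ℕ)) (hcov : ∀ t ∈ L, ∀ j, t.2.getD j 0 ≠ 0 → j ∈ ord)
    (hnd : ord.Nodup) (hlt : ∀ j ∈ ord, j < k) (x : Fin k → ℝ) :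
    evalKL k (relabelK ord L) (pushX ord x) = evalKL k L x := by
  unfold evalKL relabelK
  rw [List.map_map]
  congr 1
  refine List.map_congr_left fun t ht => ?_
  simp only [Function.comp]
  congr 1
  set f : ℕ → ℝ := fun j => xN x j ^ t.2.getD j 0 with hf
  have hlen : ord.length ≤ k := length_le_of_nodup_lt hnd hlt
  have rhs : (∏ i : Fin k, x i ^ t.2.getD i.1 0) = (ord.map f).prod := by
    have h1 : (∏ i : Fin k, x i ^ t.2.getD i.1 0) = ∏ j ∈ Finset.range k, f j := by
      rw [← Fin.prod_univ_eq_prod_range]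
      refine Finset.prod_congr rfl fun i _ => ?_
      simp [hf, xN, i.2]
    rw [h1, ← List.prod_toFinset _ hnd]
    symm
    refine Finset.prod_subset (fun j hj => Finset.mem_range.2 (hlt j (List.mem_toFinset.1 hj))) fun j _ hj => ?_
    have : t.2[j]?.getD 0 = 0 := by
      rw [← List.getD_eq_getElem?_getD]
      by_contra hne; exact hj (List.mem_toFinset.2 (hcov t ht j hne))
    simp [this]
  have lhs : (∏ i : Fin k, pushX ord x i ^ (ord.map fun j => t.2.toArray.getD j 0).getD i.1 0) = (ord.map f).prod := by
    have h1 : (∏ i : Fin k, pushX ord x i ^ (ord.map fun j => t.2.toArray.getD j 0).getD i.1 0)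
        = ∏ i ∈ Finset.range k, (if i < ord.length then f (ord.getD i k) else 1) := by
      rw [← Fin.prod_univ_eq_prod_range]
      refine Finset.prod_congr rfl fun i _ => ?_
      by_cases hi : i.1 < ord.length
      · rw [if_pos hi]
        simp only [pushX, hf, List.getD_eq_getElem?_getD, List.getElem?_map, List.getElem?_eq_getElem hi, Option.map_some,
          Option.getD_some, array_getD_eq]
      · rw [if_neg hi]
        simp [List.getD_eq_getElem?_getD, List.getElem?_eq_none (show (ord.map _).length ≤ i.1 by simpa using hi)]
    have h2 : (∏ i ∈ Finset.range k, (if i < ord.length then f (ord.getD i k) else 1))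
        = ∏ i ∈ Finset.range ord.length, f (ord.getD i k) := by
      rw [← Finset.prod_subset (Finset.range_mono hlen) (fun i _ hi => by
        rw [if_neg (by simpa using hi)])]
      exact Finset.prod_congr rfl fun i hi => if_pos (Finset.mem_range.1 hi)
    rw [h1, h2, ← List.toFinset_range, List.prod_toFinset _ List.nodup_range, map_range_getD]
  rw [lhs, rhs]

end SahiHitting

end Summit.CriticalPhenomena.PercolationContinuityZ3.Theorems
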